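import Summits.RiemannHypothesis.RiemannHypothesis.Theses.WeilComb
import Summits.RiemannHypothesis.RiemannHypothesis.Theorems.WeilCombCombShapePositivityStubSubDiagPole
import Summits.RiemannHypothesis.RiemannHypothesis.Theorems.WeilCombCombShapePositivityStubSubOffdiag
import Summits.RiemannHypothesis.RiemannHypothesis.Theorems.WeilCombCombShapePositivityStubSubArith
import Summits.RiemannHypothesis.RiemannHypothesis.Theorems.WeilCombCombShapePositivityExactPrimeWindow
import Summits.RiemannHypothesis.RiemannHypothesis.Theorems.WeilCombCombShapePositivityPolarExact
import Summits.RiemannHypothesis.RiemannHypothesis.Theorems.WeilCombCombShapePositivityArchGram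
import Summits.RiemannHypothesis.RiemannHypothesis.Theorems.WeilCombCombSubcriticalStubIdentity
import Literature.NumberTheory.LFunctions.WeilExplicit
import Literature.NumberTheory.LFunctions.WeilMellinBounds
import Literature.NumberTheory.LFunctions.WeilArchimedeanMoments

/-!
# Effective Theorem A for the fixed-shape comb: Weil positivity on the window `εM ≤ 1/128`
(crux `WeilComb.CombShapePositivity`, item stmt-RiemannHypothesis-11229, line `Sketch`; the explicit subcritical
half of Theorem B = `stub_window`)

**Theorem** (`stub_windowSub`, alias `combShapePositivity_of_mul_le_inv_128`). For every `ε > 0`, `M : ℕ`,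
`a : ℕ → ℂ` with `ε·M ≤ 1/128`, the fixed-shape log-integer comb `g = Σ_{m ≤ M} a_m φ_ε(· − log m)`,
`φ_ε(t) = ε⁻¹ φ₀(t/ε)`, `φ₀(u) = expNegInvGlue (1 − u²)`, satisfies `0 ≤ Re W(g ⋆ g̃)` — unconditionally and with
an EXPLICIT window constant (the route's Theorem A, `WeilComb.CombSubcritical`, gives an inexplicit universal `c₀`;
tracing its landed chain yields `c₀ ≈ e^{-126}`).

Proof = zeros-free explicit-formula bookkeeping with the sharp `log M` coefficient. On the window
(`M ≥ 1`, `2ε(M+1) ≤ 4εM ≤ 1/32`): `Re Q = Re P − ε⁻¹N·H(a) + Re W_∞(k)` with the prime term EXACTLY the von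
Mangoldt Helson form (p90904), `Re P = 2Re(φ̂_ε(0) conj φ̂_ε(1) A₋ conj A₊) ≥ −2e^{ε} I₀² A_m A_p` (p91841 +
`stub_subDiagPole`), `Re W_∞(k) = ‖a‖² Re W_∞(ψ_ε) + Re Σ_{m≠m'} a ā' W_∞(τ_x ψ_ε)` (p91497) with the sharp diagonal
`Re W_∞(ψ_ε) ≥ ε⁻¹N(log(1/ε) − 5/2) − N(9 + 3 log(1/ε))` (`stub_subDiagPole`: digamma form, two-level minorant of
`Re ψ(1/4+it/2)`, `|φ̂₀| ≤ I₀`, `I₀² ≤ 2N`) and the signed off-diagonal `≥ −I₀²(B_abs + S₁²)` (`stub_subOffdiag`: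
Bombieri-form brackets p93560), and the Helson ground-state identity `H = Σ‖a_m‖²(log m + ψ₁(M/m)) − D(a)`
(`WeilCombSubcritical.stub_identity`) with `ψ₁(y) < log y + 1` (Rosser–Schoenfeld), the multiscale Poincaré
inequality `Σ m log m ‖a_m‖² ≤ 2M·D + 2(log 4 + 4)M‖a‖²`, the near-diagonal Schur bound `B_abs ≤ 3M‖a‖² + 2Σ m log m‖a_m‖²`
and the pole shadow `(A_m A_p)² ≤ 4M‖a‖²(M‖a‖² + Σ m log m ‖a_m‖²)` (`stub_subArith`). The Dirichlet energy `D`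
pays the log-Hilbert form and the pole (coefficients `8λ₀` and `≈ 4λ₀`), and the budget per unit `ψ_ε(0)‖a‖²` is
`log 128 − 5/2 − 1 − 0.85 ≥ 0.5 > 0` (`assemble_sub`).
-/

noncomputable section

-- the sub-problem path `RiemannHypothesis/RiemannHypothesis` (single-conjunct summit, D-0017) duplicates a namespace
set_option linter.dupNamespace false

open scoped BigOperators ComplexConjugate
open Complex MeasureTheory

namespace Summit.RiemannHypothesis.RiemannHypothesis.Theorems.WeilCombBohrFejer

open Literature.NumberTheory.LFunctions

/-- Pure real-arithmetic assembly of the effective window: the budget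
`log 128 − 5/2 − 1 − (pole + log-Hilbert + tail constants) ≥ 0.5 > 0`. -/
theorem assemble_sub {ε Mr N I F0 F1 L D Qp B S Am Ap V H ReQ ReP Wd Off nAm nAp : ℝ}
    (hε : 0 < ε) (hM : 1 ≤ Mr) (hlam : ε * Mr ≤ 1 / 128)
    (hN : 0 ≤ N) (hI2 : I ^ 2 ≤ 2 * N)
    (hF0 : 0 ≤ F0) (hF1 : 0 ≤ F1) (hF0le : F0 ≤ Real.exp (ε / 2) * I) (hF1le : F1 ≤ Real.exp (ε / 2) * I)
    (hL : 0 ≤ L) (hD : 0 ≤ D) (hQp : 0 ≤ Qp) (hB : 0 ≤ B) (hS : S ^ 2 ≤ Mr * L)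
    (hAm : 0 ≤ Am) (hAp : 0 ≤ Ap) (hnAm : 0 ≤ nAm) (hnAp : 0 ≤ nAp) (hnAmle : nAm ≤ Am) (hnAple : nAp ≤ Ap)
    (hA2 : (Am * Ap) ^ 2 ≤ 4 * Mr * L * (Mr * L + Qp))
    (hPoinc : Qp ≤ 2 * Mr * D + 2 * (Real.log 4 + 4) * Mr * L)
    (hBle : B ≤ 3 * Mr * L + 2 * Qp) (hV : V ≤ (Real.log Mr + 1) * L)
    (hH : H = V - D)
    (hQ : ReQ = ReP - ε⁻¹ * N * H + (L * Wd + Off))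
    (hP : -(2 * (F0 * F1 * (nAm * nAp))) ≤ ReP)
    (hWd : ε⁻¹ * N * (Real.log (1 / ε) - 5 / 2) - N * (9 + 3 * Real.log (1 / ε)) ≤ Wd)
    (hOff : -(I ^ 2 * (B + S ^ 2)) ≤ Off) :
    0 ≤ ReQ := by
  -- elementary constants
  have hl2 := Real.log_two_gt_d9
  have hl2' := Real.log_two_lt_d9
  have hlog4 : Real.log 4 = 2 * Real.log 2 := by
    rw [show (4 : ℝ) = 2 ^ 2 by norm_num, Real.log_pow]; norm_num
  have hlog128 : Real.log 128 = 7 * Real.log 2 := by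
    rw [show (128 : ℝ) = 2 ^ 7 by norm_num, Real.log_pow]; norm_num
  set c : ℝ := 2 * (Real.log 4 + 4) with hc
  have hcle : c ≤ 10.78 := by rw [hc, hlog4]; linarith
  have hc0 : 0 ≤ c := by rw [hc, hlog4]; linarith
  have hM0 : 0 < Mr := by linarith
  have hε128 : ε ≤ 1 / 128 := by
    have : ε * 1 ≤ ε * Mr := mul_le_mul_of_nonneg_left hM hε.le
    linarith
  -- `log(1/ε) ≥ log Mr + log 128`
  have hlogε : Real.log Mr + Real.log 128 ≤ Real.log (1 / ε) := by
    have h1 : Real.log Mr + Real.log 128 = Real.log (128 * Mr) := by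
      rw [Real.log_mul (by norm_num) hM0.ne']; ring
    rw [h1]
    apply Real.log_le_log (by positivity)
    rw [le_div_iff₀ hε]
    calc 128 * Mr * ε = 128 * (ε * Mr) := by ring
      _ ≤ 128 * (1 / 128) := by linarith
      _ = 1 := by norm_num
  -- `ε log(1/ε) ≤ (1/128) log 128 + 1/128`
  have hεlog : ε * Real.log (1 / ε) ≤ 1 / 128 * Real.log 128 + 1 / 128 := by
    have h1 : Real.log (1 / ε) = Real.log 128 + Real.log (1 / (128 * ε)) := by
      rw [← Real.log_mul (by norm_num) (by positivity)]
      congr 1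
      field_simp
    have h2 : Real.log (1 / (128 * ε)) ≤ 1 / (128 * ε) - 1 := Real.log_le_sub_one_of_pos (by positivity)
    have h3 : ε * Real.log (1 / (128 * ε)) ≤ ε * (1 / (128 * ε) - 1) :=
      mul_le_mul_of_nonneg_left h2 hε.le
    have h4 : ε * (1 / (128 * ε) - 1) = 1 / 128 - ε := by field_simp
    have h5 : ε * Real.log 128 ≤ 1 / 128 * Real.log 128 :=
      mul_le_mul_of_nonneg_right hε128 (by rw [hlog128]; linarith)
    rw [h1, mul_add]
    linarith
  -- `e^ε ≤ 128/127`
  have hexp : Real.exp (ε / 2) * Real.exp (ε / 2) ≤ 128 / 127 := by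
    rw [← Real.exp_add, show ε / 2 + ε / 2 = ε by ring]
    have h := Real.exp_bound_div_one_sub_of_interval hε.le (by linarith : ε < 1)
    calc Real.exp ε ≤ 1 / (1 - ε) := h
      _ ≤ 128 / 127 := by
          rw [div_le_div_iff₀ (by linarith) (by norm_num)]
          linarith
  -- pole coefficient: `2 F0 F1 nAm nAp ≤ (512/127) N Am Ap`
  have hFF : F0 * F1 ≤ 128 / 127 * (2 * N) := by
    have hI0 : 0 ≤ Real.exp (ε / 2) * I := le_trans hF0 hF0le
    calc F0 * F1 ≤ (Real.exp (ε / 2) * I) * (Real.exp (ε / 2) * I) :=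
          mul_le_mul hF0le hF1le hF1 hI0
      _ = (Real.exp (ε / 2) * Real.exp (ε / 2)) * I ^ 2 := by ring
      _ ≤ 128 / 127 * (2 * N) :=
          mul_le_mul hexp hI2 (sq_nonneg _) (by positivity)
  have hAA : nAm * nAp ≤ Am * Ap := mul_le_mul hnAmle hnAple hnAp hAm
  have hpole1 : 2 * (F0 * F1 * (nAm * nAp)) ≤ 512 / 127 * N * (Am * Ap) := by
    have := mul_le_mul hFF hAA (mul_nonneg hnAm hnAp) (by positivity)
    linarith
  -- `ε Q' ≤ (2/128) D + (c/128) L`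
  have hεQ : ε * Qp ≤ 2 / 128 * D + c / 128 * L := by
    have h1 : ε * Qp ≤ ε * (2 * Mr * D + c * Mr * L) := by
      apply mul_le_mul_of_nonneg_left _ hε.le
      rw [hc]; linarith
    have h2 : ε * (2 * Mr * D + c * Mr * L) = (ε * Mr) * (2 * D + c * L) := by ring
    have h3 : (ε * Mr) * (2 * D + c * L) ≤ (1 / 128) * (2 * D + c * L) :=
      mul_le_mul_of_nonneg_right hlam (by positivity)
    rw [h2] at h1
    linarith
  -- `ε A_m A_p ≤ 0.06 L + 0.01 D`
  have hεAA : ε * (Am * Ap) ≤ 0.06 * L + 0.01 * D := by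
    have h0 : 0 ≤ ε * (Am * Ap) := by positivity
    have h0' : 0 ≤ 0.06 * L + 0.01 * D := by positivity
    rw [← pow_le_pow_iff_left₀ h0 h0' two_ne_zero]
    have h1 : (ε * (Am * Ap)) ^ 2 ≤ ε ^ 2 * (4 * Mr * L * (Mr * L + Qp)) := by
      rw [mul_pow]; exact mul_le_mul_of_nonneg_left hA2 (sq_nonneg _)
    have h2 : ε ^ 2 * (4 * Mr * L * (Mr * L + Qp)) = 4 * ((ε * Mr) * L) * ((ε * Mr) * L + ε * Qp) := by
      ring
    have hεML : (ε * Mr) * L ≤ 1 / 128 * L := mul_le_mul_of_nonneg_right hlam hL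
    have hin0 : 0 ≤ (ε * Mr) * L + ε * Qp := by positivity
    have h3 : 4 * ((ε * Mr) * L) * ((ε * Mr) * L + ε * Qp) ≤
        4 * (1 / 128 * L) * (1 / 128 * L + (2 / 128 * D + c / 128 * L)) :=
      mul_le_mul (by linarith) (by linarith) hin0 (by positivity)
    have h4 : 4 * (1 / 128 * L) * (1 / 128 * L + (2 / 128 * D + c / 128 * L)) ≤
        (0.06 * L + 0.01 * D) ^ 2 := by
      have hLL : 0 ≤ L * L := mul_nonneg hL hL
      have hLD : 0 ≤ L * D := mul_nonneg hL hD
      have hDD : 0 ≤ D * D := mul_nonneg hD hD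
      have hcLL : c * (L * L) ≤ 10.78 * (L * L) := mul_le_mul_of_nonneg_right hcle hLL
      have e1 : 4 * (1 / 128 * L) * (1 / 128 * L + (2 / 128 * D + c / 128 * L)) =
          4 / 16384 * (L * L) + 8 / 16384 * (L * D) + 4 / 16384 * (c * (L * L)) := by ring
      have e2 : (0.06 * L + 0.01 * D) ^ 2 =
          0.0036 * (L * L) + 0.0012 * (L * D) + 0.0001 * (D * D) := by ring
      rw [e1, e2]
      linarith
    rw [h2] at h1
    exact h1.trans (h3.trans h4)
  -- the log-Hilbert form and the ℓ¹ tail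
  have hεML : (ε * Mr) * L ≤ 1 / 128 * L := mul_le_mul_of_nonneg_right hlam hL
  have hεB : 2 * ε * B ≤ 6 / 128 * L + 4 * (2 / 128 * D + c / 128 * L) := by
    have h1 : ε * B ≤ ε * (3 * Mr * L + 2 * Qp) := mul_le_mul_of_nonneg_left hBle hε.le
    have h2 : ε * (3 * Mr * L + 2 * Qp) = 3 * ((ε * Mr) * L) + 2 * (ε * Qp) := by ring
    rw [h2] at h1
    linarith
  have hεS : 2 * ε * S ^ 2 ≤ 2 / 128 * L := by
    have h1 : ε * S ^ 2 ≤ ε * (Mr * L) := mul_le_mul_of_nonneg_left hS hε.le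
    have h2 : ε * (Mr * L) = (ε * Mr) * L := by ring
    linarith
  have hεL : ε * L ≤ 1 / 128 * L := mul_le_mul_of_nonneg_right hε128 hL
  have h128lo : 4.852 ≤ Real.log 128 := by rw [hlog128]; linarith
  have h128hi : Real.log 128 ≤ 4.8521 := by rw [hlog128]; linarith
  have hεlog' : ε * Real.log (1 / ε) ≤ 4.8521 / 128 + 1 / 128 := by linarith
  have hlogε' : Real.log Mr + 4.852 ≤ Real.log (1 / ε) := by linarith
  have hεlogL : (ε * Real.log (1 / ε)) * L ≤ (4.8521 / 128 + 1 / 128) * L :=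
    mul_le_mul_of_nonneg_right hεlog' hL
  have hlogL : (Real.log Mr + 4.852) * L ≤ Real.log (1 / ε) * L :=
    mul_le_mul_of_nonneg_right hlogε' hL
  have hcL : c * L ≤ 10.78 * L := mul_le_mul_of_nonneg_right hcle hL
  -- the ε-rescaled bracket is nonnegative (the budget)
  have hX : 0 ≤ -(512 / 127) * (ε * (Am * Ap)) - V + D + (Real.log (1 / ε) - 5 / 2) * L -
      (9 * (ε * L) + 3 * ((ε * Real.log (1 / ε)) * L)) - 2 * ε * B - 2 * ε * S ^ 2 := by
    linarith
  -- `ReQ ≥ (N/ε) · bracket`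
  have hWdL : L * (ε⁻¹ * N * (Real.log (1 / ε) - 5 / 2) - N * (9 + 3 * Real.log (1 / ε))) ≤ L * Wd :=
    mul_le_mul_of_nonneg_left hWd hL
  have hOff' : -(2 * N * (B + S ^ 2)) ≤ Off := by
    have hBS : 0 ≤ B + S ^ 2 := by positivity
    have := mul_le_mul_of_nonneg_right hI2 hBS
    linarith
  have hR : -(512 / 127) * N * (Am * Ap) - ε⁻¹ * N * V + ε⁻¹ * N * D +
      L * (ε⁻¹ * N * (Real.log (1 / ε) - 5 / 2) - N * (9 + 3 * Real.log (1 / ε))) -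
        2 * N * (B + S ^ 2) ≤ ReQ := by
    rw [hH] at hQ
    linarith
  have e : ε⁻¹ * N * (-(512 / 127) * (ε * (Am * Ap)) - V + D + (Real.log (1 / ε) - 5 / 2) * L -
      (9 * (ε * L) + 3 * ((ε * Real.log (1 / ε)) * L)) - 2 * ε * B - 2 * ε * S ^ 2) =
      -(512 / 127) * N * (Am * Ap) - ε⁻¹ * N * V + ε⁻¹ * N * D +
      L * (ε⁻¹ * N * (Real.log (1 / ε) - 5 / 2) - N * (9 + 3 * Real.log (1 / ε))) -
        2 * N * (B + S ^ 2) := by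
    field_simp
    ring
  have hNε : 0 ≤ ε⁻¹ * N := mul_nonneg (inv_nonneg.2 hε.le) hN
  have := mul_nonneg hNε hX
  rw [e] at this
  linarith

/-- **EFFECTIVE THEOREM A (`stub_windowSub`, glued).** For `ε > 0`, `M`, `a` with `εM ≤ 1/128` the fixed-shape
comb has `0 ≤ Re Q(g)`.  `M = 0`: `Q(0) = 0`.  `M ≥ 1` (then `2ε(M+1) ≤ 4εM ≤ 1/32`):
`Re Q = Re P − ε⁻¹N·H + Re W_∞(k)` (p90904); `Re P ≥ −2|φ̂_ε(0)||φ̂_ε(1)||A₋||A₊|` (p91841);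
`Re W_∞(k) = L·Re W_∞(ψ_ε) + Re Σ_{m≠m'} a ā' W_∞(τ_x ψ_ε)` (p91497); `H = Σ‖a_m‖²V_m − D` (`stub_identity`);
then `stub_subDiagPole`, `stub_subOffdiag`, `stub_subArith` and `assemble_sub`. -/
theorem stub_windowSub : ∀ ε : ℝ, 0 < ε → ∀ (M : ℕ) (a : ℕ → ℂ), ε * M ≤ 1 / 128 →
    0 ≤ (weilQuadratic (fun x : ℝ => ∑ m ∈ Finset.Icc 1 M,
        a m * ((ε : ℂ)⁻¹ * ((expNegInvGlue (1 - ((x - Real.log (m : ℝ)) / ε) ^ 2) : ℝ) : ℂ)))).re := by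
  intro ε hε M a hlam
  rcases Nat.eq_zero_or_pos M with hM0 | hMpos
  · subst hM0
    have h0 : (fun x : ℝ => ∑ m ∈ Finset.Icc 1 0,
        a m * ((ε : ℂ)⁻¹ * ((expNegInvGlue (1 - ((x - Real.log (m : ℝ)) / ε) ^ 2) : ℝ) : ℂ))) = 0 := by
      funext x
      simp
    rw [h0, weilQuadratic_zero]
    simp
  have hM : 1 ≤ M := hMpos
  have hMr : (1 : ℝ) ≤ (M : ℝ) := by exact_mod_cast hM
  have hw : 2 * ε * ((M : ℝ) + 1) ≤ 1 := by nlinarith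
  have h4 : 4 * ε * M ≤ 1 := by nlinarith
  have hε4 : ε ≤ 1 / 4 := by nlinarith
  -- names
  set φε : ℝ → ℂ := fun t : ℝ => (ε : ℂ)⁻¹ * ((expNegInvGlue (1 - (t / ε) ^ 2) : ℝ) : ℂ) with hφε
  set ψε : ℝ → ℂ := weilConv φε (weilReflect φε) with hψε
  set N : ℝ := weilNorm2Sq (fun u : ℝ => ((expNegInvGlue (1 - u ^ 2) : ℝ) : ℂ)) with hN
  set I : ℝ := ∫ u : ℝ, expNegInvGlue (1 - u ^ 2) with hI
  set L : ℝ := ∑ m ∈ Finset.Icc 1 M, ‖a m‖ ^ 2 with hL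
  set H : ℝ := 2 * (∑ m ∈ Finset.Icc 1 M, ∑ n ∈ Finset.Icc 1 (M / m),
      ((ArithmeticFunction.vonMangoldt n : ℝ) : ℂ) / (Real.sqrt n : ℂ) * a (n * m) *
        conj (a m)).re with hH
  set V : ℝ := ∑ m ∈ Finset.Icc 1 M, ‖a m‖ ^ 2 *
      (Real.log m + ∑ n ∈ Finset.Icc 1 (M / m), (ArithmeticFunction.vonMangoldt n : ℝ) / n) with hV
  set D : ℝ := ∑ m ∈ Finset.Icc 1 M, ∑ n ∈ Finset.Icc 1 (M / m),
      (ArithmeticFunction.vonMangoldt n : ℝ) * ‖a (n * m) - ((Real.sqrt n : ℂ))⁻¹ * a m‖ ^ 2 with hD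
  set Qp : ℝ := ∑ m ∈ Finset.Icc 1 M, (m : ℝ) * Real.log m * ‖a m‖ ^ 2 with hQp
  set B : ℝ := ∑ m ∈ Finset.Icc 1 M, ∑ m' ∈ (Finset.Icc 1 M).erase m,
      ‖a m‖ * ‖a m'‖ / |Real.log m - Real.log m'| with hB
  set S : ℝ := ∑ m ∈ Finset.Icc 1 M, ‖a m‖ with hS
  set Am : ℝ := ∑ m ∈ Finset.Icc 1 M, ‖a m‖ / Real.sqrt m with hAm
  set Ap : ℝ := ∑ m ∈ Finset.Icc 1 M, ‖a m‖ * Real.sqrt m with hAp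
  set Aminus : ℂ := ∑ m ∈ Finset.Icc 1 M, a m * ((Real.sqrt (m : ℝ) : ℝ) : ℂ)⁻¹ with hAminus
  set Aplus : ℂ := ∑ m ∈ Finset.Icc 1 M, a m * ((Real.sqrt (m : ℝ) : ℝ) : ℂ) with hAplus
  set F0 : ℝ := ‖weilMellin φε 0‖ with hF0
  set F1 : ℝ := ‖weilMellin φε 1‖ with hF1
  set Wd : ℝ := (weilArchTerm ψε).re with hWd
  set Off : ℝ := (∑ m ∈ Finset.Icc 1 M, ∑ m' ∈ (Finset.Icc 1 M).erase m,
      a m * conj (a m') * weilArchTerm (weilTranslate ψε (Real.log (m : ℝ) - Real.log (m' : ℝ)))).re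
    with hOff
  -- the stubs
  obtain ⟨hdiag, hcoef, hI2⟩ := stub_subDiagPole
  have hWd' := hdiag ε hε hε4
  obtain ⟨hF0le, hF1le⟩ := hcoef ε hε
  have hOff' := stub_subOffdiag ε hε M a h4
  obtain ⟨hPoinc, hBle, hA2, hVle⟩ := stub_subArith M a
  have hId := Summit.RiemannHypothesis.RiemannHypothesis.Theorems.WeilCombSubcritical.stub_identity M a
  -- Step 1: exact window identity, polar identity, archimedean Gram form
  have h1 := weilQuadratic_comb_re_exactWindow ε hε M a hM hw
  have h2 := weilPolarTerm_comb_re ε hε M a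
  have h3 := weilArchTerm_comb_eq_sum ε hε M a
  -- Step 2: the polar bound `Re P ≥ −2 F0 F1 ‖A₋‖ ‖A₊‖`
  have hP : -(2 * (F0 * F1 * (‖Aminus‖ * ‖Aplus‖))) ≤
      2 * (weilMellin φε 0 * conj (weilMellin φε 1) * (Aminus * conj Aplus)).re := by
    have hn : ‖weilMellin φε 0 * conj (weilMellin φε 1) * (Aminus * conj Aplus)‖ =
        F0 * F1 * (‖Aminus‖ * ‖Aplus‖) := by
      rw [norm_mul, norm_mul, norm_mul, Complex.norm_conj, Complex.norm_conj]
    have h := Complex.abs_re_le_norm (weilMellin φε 0 * conj (weilMellin φε 1) * (Aminus * conj Aplus))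
    rw [hn] at h
    have := (abs_le.1 h).1
    linarith
  have hnAm : ‖Aminus‖ ≤ Am := by
    rw [hAminus, hAm]
    refine (norm_sum_le _ _).trans (le_of_eq (Finset.sum_congr rfl fun m _ => ?_))
    rw [norm_mul, norm_inv, Complex.norm_real, Real.norm_eq_abs, abs_of_nonneg (Real.sqrt_nonneg _),
      div_eq_mul_inv]
  have hnAp : ‖Aplus‖ ≤ Ap := by
    rw [hAplus, hAp]
    refine (norm_sum_le _ _).trans (le_of_eq (Finset.sum_congr rfl fun m _ => ?_))
    rw [norm_mul, Complex.norm_real, Real.norm_eq_abs, abs_of_nonneg (Real.sqrt_nonneg _)]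
  -- Step 3: split the archimedean Gram form into diagonal and off-diagonal parts
  have hdiagsplit : (weilArchTerm (weilConv (fun x : ℝ => ∑ m ∈ Finset.Icc 1 M,
        a m * ((ε : ℂ)⁻¹ * ((expNegInvGlue (1 - ((x - Real.log (m : ℝ)) / ε) ^ 2) : ℝ) : ℂ)))
      (weilReflect (fun x : ℝ => ∑ m ∈ Finset.Icc 1 M,
        a m * ((ε : ℂ)⁻¹ * ((expNegInvGlue (1 - ((x - Real.log (m : ℝ)) / ε) ^ 2) : ℝ) : ℂ)))))).re =
      L * Wd + Off := by
    rw [h3]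
    have hT0 : ∀ h : ℝ → ℂ, weilTranslate h 0 = h := fun h => funext fun t => by simp [weilTranslate]
    have e : ∀ m ∈ Finset.Icc 1 M,
        ∑ m' ∈ Finset.Icc 1 M, a m * conj (a m') *
            weilArchTerm (weilTranslate ψε (Real.log (m : ℝ) - Real.log (m' : ℝ))) =
          ((‖a m‖ ^ 2 : ℝ) : ℂ) * weilArchTerm ψε +
            ∑ m' ∈ (Finset.Icc 1 M).erase m, a m * conj (a m') *
              weilArchTerm (weilTranslate ψε (Real.log (m : ℝ) - Real.log (m' : ℝ))) := by
      intro m hm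
      rw [← Finset.add_sum_erase _ _ hm, sub_self, hT0, Complex.mul_conj']
      push_cast
      ring
    rw [Finset.sum_congr rfl e, Finset.sum_add_distrib, Complex.add_re, Complex.re_sum]
    congr 1
    rw [hL, Finset.sum_mul]
    refine Finset.sum_congr rfl fun m _ => ?_
    rw [Complex.re_ofReal_mul]
  -- Step 4: assemble
  have hQ : (weilQuadratic (fun x : ℝ => ∑ m ∈ Finset.Icc 1 M,
        a m * ((ε : ℂ)⁻¹ * ((expNegInvGlue (1 - ((x - Real.log (m : ℝ)) / ε) ^ 2) : ℝ) : ℂ)))).re =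
      2 * (weilMellin φε 0 * conj (weilMellin φε 1) * (Aminus * conj Aplus)).re - ε⁻¹ * N * H +
        (L * Wd + Off) := by
    rw [h1, h2, hdiagsplit]
  have hS2 : S ^ 2 ≤ (M : ℝ) * L := by
    have h := sq_sum_le_card_mul_sum_sq (s := Finset.Icc 1 M) (f := fun m => ‖a m‖)
    rw [Nat.card_Icc, Nat.add_sub_cancel] at h
    simpa [hS, hL] using h
  have hQp0 : 0 ≤ Qp := by
    refine Finset.sum_nonneg fun m hm => ?_
    have hm1 : (1 : ℝ) ≤ m := by exact_mod_cast (Finset.mem_Icc.1 hm).1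
    have : 0 ≤ Real.log m := Real.log_nonneg hm1
    positivity
  exact assemble_sub (ε := ε) (Mr := (M : ℝ)) (N := N) (I := I) (F0 := F0) (F1 := F1) (L := L) (D := D)
    (Qp := Qp) (B := B) (S := S) (Am := Am) (Ap := Ap) (V := V) (H := H) (Wd := Wd) (Off := Off)
    (nAm := ‖Aminus‖) (nAp := ‖Aplus‖)
    hε hMr hlam (weilNorm2Sq_nonneg _) hI2 (norm_nonneg _) (norm_nonneg _) hF0le hF1le
    (Finset.sum_nonneg fun _ _ => by positivity)
    (Finset.sum_nonneg fun _ _ => Finset.sum_nonneg fun _ _ => by positivity) hQp0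
    (Finset.sum_nonneg fun _ _ => Finset.sum_nonneg fun _ _ => by positivity) hS2
    (Finset.sum_nonneg fun _ _ => by positivity) (Finset.sum_nonneg fun _ _ => by positivity)
    (norm_nonneg _) (norm_nonneg _) hnAm hnAp hA2 hPoinc hBle hVle hId hQ hP hWd' hOff'

/-- **Effective Theorem A (alias).** `εM ≤ 1/128 ⇒ 0 ≤ Re W(g ⋆ g̃)` for the fixed-shape comb; the cells
`(ε, M)` of `WeilComb.CombShapePositivity` with `εM ≤ 1/128` hold unconditionally. -/
theorem combShapePositivity_of_mul_le_inv_128 {ε : ℝ} (hε : 0 < ε) {M : ℕ} (a : ℕ → ℂ)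
    (h : ε * M ≤ 1 / 128) :
    0 ≤ (weilQuadratic (fun x : ℝ => ∑ m ∈ Finset.Icc 1 M,
        a m * ((ε : ℂ)⁻¹ * ((expNegInvGlue (1 - ((x - Real.log (m : ℝ)) / ε) ^ 2) : ℝ) : ℂ)))).re :=
  stub_windowSub ε hε M a h

end Summit.RiemannHypothesis.RiemannHypothesis.Theorems.WeilCombBohrFejer

end
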